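import Summits.Parity.BatemanHorn.Theorems.AlmostPrimeZerosSystemMomentDeficitAssemblyAlgebra
import Literature.NumberTheory.Sieve.ParityWave0SchinzelBatemanHornProofs
import Literature.NumberTheory.Sieve.PolynomialValuesSieveSequence

/-!
# Crux `SystemMomentDeficit` (stmt-Parity-11326), line `Ideator3Sketch`: the system decouples into its members

Registered stub `stub_roughClassDeficit_of_roughAPLower` (bridge 2 of the reshaped skeleton, lead c1):
the rough-class deficit bound RCD for every Bateman–Horn SYSTEM follows from the residue-class
bound RAL for every irreducible POLYNOMIAL of positive degree and positive leading coefficient.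

Proof.  `N = Σⱼ N_{fⱼ}`; for `n ≥ n₀(f)`, `q ∣ fᵢ(n)⁺ ≠ 0` iff `n mod q` is one of the `ρᵢ(q) ≤ D` roots of
`fᵢ mod q` (`dvd_eval_iff_dvd_eval_mod`), so `Σ_{q ∣ fᵢ(n)⁺ ≠ 0} Nⱼ(n) ≥ Σ_{s root} Σ_{n ≡ s} Nⱼ(n) − n₀K`,
`#{n ≤ x : q ∣ fᵢ(n)⁺ ≠ 0} ≤ ρᵢ(q)(Y/q + 1)`, `0 ≤ Nⱼ ≤ K`; RAL bounds each `Σ_{n ≡ s} Nⱼ(n)` from below and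
the `O(1/Y)` losses are `≤ 4K(n₀ + D) Λ(q)/(q log x)` (`q log x ≤ 2x` for `q ≤ √x`).
Notation (docstrings only): `Y = x + 1`, `PP(z)` = primes `≤ z` ∪ prime squares `≤ z`,
`Nⱼ(n) = s(fⱼ(n)⁺) − #{r ∈ PP(x) : r ∣ fⱼ(n)⁺ ≠ 0}`, `D = Σᵢ deg fᵢ · Mᵢ`, `K = Σᵢ 2(deg fᵢ + H(fᵢ))`.  [folklore]
-/

namespace Summit.Parity.BatemanHorn.Cruxes.SystemMomentDeficit.Ideator3Sketch

open scoped BigOperators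
open Finset Polynomial
open Literature.NumberTheory.Sieve
open Summit.Parity.BatemanHorn.Theorems.AlmostPrimeZeros.SystemMertens

/-- `q log x ≤ 2(x + 1) Λ(q)·2` in the form used below: for a prime power `2 ≤ q` with `q² ≤ x`,
`1/(x+1) ≤ 4 Λ(q)/(q log x)` (`Λ(q) ≥ log 2 ≥ 1/2`, `log x ≤ 2√x`, `q ≤ √x`). [folklore] -/
theorem inv_succ_le_vonMangoldt_div {x q : ℕ} (hx : 2 ≤ x) (hq : IsPrimePow q) (hqx : q * q ≤ x) :
    1 / ((x : ℝ) + 1) ≤ 4 * ArithmeticFunction.vonMangoldt q / ((q : ℝ) * Real.log x) := by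
  obtain ⟨p, a, hp, ha, rfl⟩ := (isPrimePow_nat_iff q).1 hq
  have hΛ : (1 : ℝ) / 2 ≤ ArithmeticFunction.vonMangoldt (p ^ a) := by
    rw [ArithmeticFunction.vonMangoldt_apply_pow (by omega),
      ArithmeticFunction.vonMangoldt_apply_prime hp]
    have h2 : Real.log 2 ≤ Real.log p :=
      Real.log_le_log (by norm_num) (by exact_mod_cast hp.two_le)
    have := Real.log_two_gt_d9
    linarith
  have hq2 : 2 ≤ p ^ a := le_trans hp.two_le (Nat.le_self_pow (by omega) p)
  have hxR : (2 : ℝ) ≤ x := by exact_mod_cast hx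
  have hx0 : (0 : ℝ) < x := by linarith
  have hq0 : (0 : ℝ) < ((p ^ a : ℕ) : ℝ) := by exact_mod_cast (show 0 < p ^ a by omega)
  have hlogx : 0 < Real.log x := Real.log_pos (by linarith)
  -- `q ≤ √x` and `log x ≤ 2 √x`
  have hqs : ((p ^ a : ℕ) : ℝ) ≤ Real.sqrt x := by
    have h : ((p ^ a : ℕ) : ℝ) ^ 2 ≤ x := by exact_mod_cast (by nlinarith : (p ^ a) ^ 2 ≤ x)
    calc ((p ^ a : ℕ) : ℝ) = Real.sqrt (((p ^ a : ℕ) : ℝ) ^ 2) := (Real.sqrt_sq hq0.le).symm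
      _ ≤ Real.sqrt x := Real.sqrt_le_sqrt h
  have hls : Real.log x ≤ 2 * Real.sqrt x := by
    have h := Real.log_le_rpow_div hx0.le (by norm_num : (0 : ℝ) < 1 / 2)
    rw [← Real.sqrt_eq_rpow] at h
    linarith
  have hs0 : 0 ≤ Real.sqrt x := Real.sqrt_nonneg x
  have hss : Real.sqrt x * Real.sqrt x = x := Real.mul_self_sqrt hx0.le
  -- `q log x ≤ 2x`
  have hql : ((p ^ a : ℕ) : ℝ) * Real.log x ≤ 2 * x := by
    calc ((p ^ a : ℕ) : ℝ) * Real.log x ≤ Real.sqrt x * (2 * Real.sqrt x) :=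
          mul_le_mul hqs hls hlogx.le hs0
      _ = 2 * x := by rw [mul_comm, mul_assoc, hss]
  rw [div_le_div_iff₀ (by positivity) (by positivity)]
  nlinarith

/-- **RCD from RAL, member by member** (registered stub `stub_roughClassDeficit_of_roughAPLower` of
line `Ideator3Sketch`): if every irreducible `g ∈ ℤ[X]` of positive degree and positive leading
coefficient satisfies the residue-class bound RAL, then every Bateman–Horn system satisfies the
rough-class deficit bound RCD. -/
theorem stub_roughClassDeficit_of_roughAPLower :
    (∀ g : ℤ[X], Irreducible g → 0 < g.natDegree → 0 < g.leadingCoeff →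
      ∃ C : ℝ, ∀ x : ℕ, 16 ≤ x →
        ∀ q ∈ (Nat.primesLE (Nat.sqrt (Nat.sqrt x)) ∪
            ((Nat.primesLE (Nat.sqrt (Nat.sqrt x))).filter
              (fun p => p ^ 2 ≤ Nat.sqrt (Nat.sqrt x))).image (fun p => p ^ 2)),
          ∀ r : ℕ, r < q →
            1 / (q : ℝ) * ((∑ n ∈ Finset.range (x + 1),
                (((((g.eval (n : ℤ)).toNat.factorization.sum fun _ v => min v 2) : ℕ) : ℝ) -
                (#((Nat.primesLE x ∪ ((Nat.primesLE x).filter (fun p => p ^ 2 ≤ x)).image (fun p => p ^ 2)).filter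
                  (fun r' => r' ∣ (g.eval (n : ℤ)).toNat ∧ (g.eval (n : ℤ)).toNat ≠ 0)) : ℝ))) / ((x : ℝ) + 1)) -
              C * ArithmeticFunction.vonMangoldt q / ((q : ℝ) * Real.log x) ≤
            (∑ n ∈ (Finset.range (x + 1)).filter (fun n : ℕ => n % q = r),
                (((((g.eval (n : ℤ)).toNat.factorization.sum fun _ v => min v 2) : ℕ) : ℝ) -
                (#((Nat.primesLE x ∪ ((Nat.primesLE x).filter (fun p => p ^ 2 ≤ x)).image (fun p => p ^ 2)).filter
                  (fun r' => r' ∣ (g.eval (n : ℤ)).toNat ∧ (g.eval (n : ℤ)).toNat ≠ 0)) : ℝ))) / ((x : ℝ) + 1)) →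
    ∀ (k : ℕ) (f : Fin k → ℤ[X]), IsBatemanHornSystem f → ∃ C : ℝ, ∀ x : ℕ, 16 ≤ x →
      ∀ q ∈ (Nat.primesLE (Nat.sqrt (Nat.sqrt x)) ∪
          ((Nat.primesLE (Nat.sqrt (Nat.sqrt x))).filter
            (fun p => p ^ 2 ≤ Nat.sqrt (Nat.sqrt x))).image (fun p => p ^ 2)),
        -(C * ArithmeticFunction.vonMangoldt q / ((q : ℝ) * Real.log x)) ≤
          ∑ i, ((∑ n ∈ (Finset.range (x + 1)).filter
                  (fun n : ℕ => q ∣ ((f i).eval (n : ℤ)).toNat ∧ ((f i).eval (n : ℤ)).toNat ≠ 0),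
                (((∑ j, (((f j).eval (n : ℤ)).toNat.factorization.sum fun _ v => min v 2) : ℕ) : ℝ) -
                  ((∑ j, #((Nat.primesLE x ∪ ((Nat.primesLE x).filter (fun p => p ^ 2 ≤ x)).image
                      (fun p => p ^ 2)).filter
                    (fun r => r ∣ ((f j).eval (n : ℤ)).toNat ∧ ((f j).eval (n : ℤ)).toNat ≠ 0)) : ℕ) :
                    ℝ))) /
                ((x : ℝ) + 1) -
            (#((Finset.range (x + 1)).filter
                (fun n : ℕ => q ∣ ((f i).eval (n : ℤ)).toNat ∧ ((f i).eval (n : ℤ)).toNat ≠ 0)) : ℝ) /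
                ((x : ℝ) + 1) *
              ((∑ n ∈ Finset.range (x + 1),
                  (((∑ j, (((f j).eval (n : ℤ)).toNat.factorization.sum fun _ v => min v 2) : ℕ) : ℝ) -
                    ((∑ j, #((Nat.primesLE x ∪ ((Nat.primesLE x).filter (fun p => p ^ 2 ≤ x)).image
                        (fun p => p ^ 2)).filter
                      (fun r => r ∣ ((f j).eval (n : ℤ)).toNat ∧ ((f j).eval (n : ℤ)).toNat ≠ 0)) : ℕ) :
                      ℝ))) /
                ((x : ℝ) + 1))) := by
  intro hRAL k f hf
  classical
  /- ### constants -/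
  choose Cg hCg using fun i => hRAL (f i) (hf.irreducible i) (hf.natDegree_pos i) (hf.leadingCoeff_pos i)
  have hpos : ∀ i : Fin k, ∃ n₀ : ℕ, ∀ n : ℕ, n₀ ≤ n → 0 < (f i).eval (n : ℤ) := fun i =>
    Filter.eventually_atTop.1 (eventually_eval_natCast_pos (hf.natDegree_pos i) (hf.leadingCoeff_pos i))
  choose n0 hn0 using hpos
  set n₀ : ℕ := ∑ i, n0 i with hn₀def
  have hn₀ : ∀ (i : Fin k) (n : ℕ), n₀ ≤ n → 0 < (f i).eval (n : ℤ) := fun i n hn =>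
    hn0 i n ((single_le_sum (f := fun i => n0 i) (fun _ _ => Nat.zero_le _) (mem_univ i)).trans hn)
  choose M hM1 hM hρ using fun i => exists_rootCount_primePow_le (hf.irreducible i) (hf.natDegree_pos i)
  set D : ℝ := ∑ i, ((f i).natDegree : ℝ) * (M i : ℝ) with hD
  set K : ℝ := ∑ i, (2 * (((f i).natDegree : ℝ) +
    ((∑ j ∈ range ((f i).natDegree + 1), ((f i).coeff j).natAbs : ℕ) : ℝ))) with hK
  have hD0 : 0 ≤ D := sum_nonneg fun i _ => by positivity
  have hK0 : 0 ≤ K := sum_nonneg fun i _ => by positivity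
  have hρD : ∀ (i : Fin k) (p a : ℕ), p.Prime → (polyRootCountMod ![f i] (p ^ a) : ℝ) ≤ D := by
    intro i p a hp
    have h1 : (polyRootCountMod ![f i] (p ^ a) : ℝ) ≤ ((f i).natDegree : ℝ) * (M i : ℝ) := by
      exact_mod_cast hM i p hp a
    rw [hD]
    exact h1.trans (single_le_sum (f := fun i => ((f i).natDegree : ℝ) * (M i : ℝ))
      (fun i _ => by positivity) (mem_univ i))
  have hKi : ∀ i : Fin k, (2 * (((f i).natDegree : ℝ) +
      ((∑ j ∈ range ((f i).natDegree + 1), ((f i).coeff j).natAbs : ℕ) : ℝ))) ≤ K := fun i => by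
    rw [hK]; exact single_le_sum (f := fun i => (2 * (((f i).natDegree : ℝ) +
      ((∑ j ∈ range ((f i).natDegree + 1), ((f i).coeff j).natAbs : ℕ) : ℝ)))) (fun i _ => by positivity) (mem_univ i)
  clear_value D K
  refine ⟨∑ _i : Fin k, ∑ j : Fin k, (D * |Cg j| + 4 * K * ((n₀ : ℝ) + D)), fun x hx q hq => ?_⟩
  /- ### parameters at `x`, `q` -/
  obtain ⟨hpp, hq2, hqy⟩ := isPrimePow_and_le_of_mem_PP hq
  have hx1 : 1 ≤ x := by omega
  have hY0 : (0 : ℝ) < (x : ℝ) + 1 := by positivity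
  have hq0 : 0 < q := by omega
  have hq0R : (0 : ℝ) < q := by exact_mod_cast hq0
  have hxR : (16 : ℝ) ≤ x := by exact_mod_cast hx
  have hlogx : 0 < Real.log x := Real.log_pos (by linarith)
  have hΛ0 : 0 ≤ ArithmeticFunction.vonMangoldt q := ArithmeticFunction.vonMangoldt_nonneg
  have ht0 : 0 ≤ ArithmeticFunction.vonMangoldt q / ((q : ℝ) * Real.log x) := by positivity
  have hqqx : q * q ≤ x := by
    have h1 : q ≤ Nat.sqrt x := hqy.trans (Nat.sqrt_le_self _)
    exact Nat.le_sqrt.1 h1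
  have hsmall : 1 / ((x : ℝ) + 1) ≤ 4 * ArithmeticFunction.vonMangoldt q / ((q : ℝ) * Real.log x) :=
    inv_succ_le_vonMangoldt_div (by omega) hpp hqqx
  have hqPx : q ∈ (Nat.primesLE x ∪ ((Nat.primesLE x).filter (fun p => p ^ 2 ≤ x)).image (fun p => p ^ 2)) :=
    PP_mono ((Nat.sqrt_le_self _).trans (Nat.sqrt_le_self x)) hq
  -- RAL for the members at this `x`, `q` (before freezing anything)
  have hRALx := fun j (s : ℕ) (hs : s < q) => hCg j x hx q hq s hs
  /- ### the member rough counts `Ng j` and the system rough count `Nf` -/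
  set Px : Finset ℕ := (Nat.primesLE x ∪ ((Nat.primesLE x).filter (fun p => p ^ 2 ≤ x)).image (fun p => p ^ 2)) with hPx
  obtain ⟨Ng, hNg⟩ : ∃ Ng : Fin k → ℕ → ℝ, Ng = fun j (n : ℕ) =>
      (((((f j).eval (n : ℤ)).toNat.factorization.sum fun _ v => min v 2) : ℕ) : ℝ) -
        (#(Px.filter (fun r' => r' ∣ ((f j).eval (n : ℤ)).toNat ∧ ((f j).eval (n : ℤ)).toNat ≠ 0)) : ℝ) :=
    ⟨_, rfl⟩
  obtain ⟨Nf, hNf⟩ : ∃ Nf : ℕ → ℝ, Nf = fun (n : ℕ) =>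
      (((∑ j, (((f j).eval (n : ℤ)).toNat.factorization.sum fun _ v => min v 2) : ℕ) : ℝ) -
        ((∑ j, #(Px.filter
          (fun r => r ∣ ((f j).eval (n : ℤ)).toNat ∧ ((f j).eval (n : ℤ)).toNat ≠ 0)) : ℕ) : ℝ)) :=
    ⟨_, rfl⟩
  have hNfsum : ∀ n, Nf n = ∑ j, Ng j n := fun n => by
    rw [hNf, hNg]
    simp only
    push_cast
    rw [sum_sub_distrib]
  have hNg0 : ∀ j n, 0 ≤ Ng j n := fun j n => by
    rw [hNg]
    simp only [sub_nonneg]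
    rw [hPx]
    exact_mod_cast card_PP_filter_le_capped x _
  have hNgK : ∀ j, ∀ n ∈ range (x + 1), Ng j n ≤ K := fun j n hn => by
    have hnx : n ≤ x := Nat.lt_succ_iff.1 (mem_range.1 hn)
    rw [hNg]
    simp only
    have h1 := capped_le_card_PP_filter_add (f j) hx1 hnx
    rw [← hPx] at h1
    have h2 : (((((f j).eval (n : ℤ)).toNat.factorization.sum fun _ v => min v 2) : ℕ) : ℝ) ≤
        (#(Px.filter (fun r' => r' ∣ ((f j).eval (n : ℤ)).toNat ∧ ((f j).eval (n : ℤ)).toNat ≠ 0)) : ℝ) +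
          2 * (((f j).natDegree : ℝ) +
            ((∑ j' ∈ range ((f j).natDegree + 1), ((f j).coeff j').natAbs : ℕ) : ℝ)) := by
      exact_mod_cast h1
    linarith [hKi j]
  have hEj0 : ∀ j, 0 ≤ (∑ n ∈ range (x + 1), Ng j n) / ((x : ℝ) + 1) := fun j =>
    div_nonneg (sum_nonneg fun n _ => hNg0 j n) hY0.le
  have hEjK : ∀ j, (∑ n ∈ range (x + 1), Ng j n) / ((x : ℝ) + 1) ≤ K := fun j => by
    rw [div_le_iff₀ hY0]
    calc ∑ n ∈ range (x + 1), Ng j n ≤ ∑ _n ∈ range (x + 1), K := sum_le_sum (hNgK j)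
      _ = K * ((x : ℝ) + 1) := by rw [sum_const, card_range, nsmul_eq_mul]; push_cast; ring
  -- RAL in `Ng`-form
  have hRAL' : ∀ (j : Fin k) (s : ℕ), s < q →
      1 / (q : ℝ) * ((∑ n ∈ range (x + 1), Ng j n) / ((x : ℝ) + 1)) -
          Cg j * ArithmeticFunction.vonMangoldt q / ((q : ℝ) * Real.log x) ≤
        (∑ n ∈ (range (x + 1)).filter (fun n : ℕ => n % q = s), Ng j n) / ((x : ℝ) + 1) := by
    intro j s hs
    have h := hRALx j s hs
    rw [hNg]
    exact h
  /- ### the indicator of `q ∣ fᵢ(n)⁺ ≠ 0` versus the root classes of `fᵢ mod q` -/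
  -- root residues of `fᵢ` modulo `q`
  set Rt : Fin k → Finset ℕ := fun i => (range q).filter (fun s : ℕ => (q : ℤ) ∣ (f i).eval (s : ℤ))
    with hRt
  have hRt_card : ∀ i, (#(Rt i) : ℝ) ≤ D := fun i => by
    obtain ⟨p, a, hp, ha, rfl⟩ := (isPrimePow_nat_iff q).1 hpp
    have h := hρD i p a hp
    rwa [polyRootCountMod_single] at h
  have hRt_lt : ∀ i, ∀ s ∈ Rt i, s < q := fun i s hs => mem_range.1 (mem_filter.1 hs).1
  -- Claim A: `Σ_{q ∣ fᵢ(n)⁺ ≠ 0} Ng j n ≥ Σ_{s ∈ Rt i} Σ_{n ≡ s} Ng j n − n₀ K`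
  have hA : ∀ i j, ∑ s ∈ Rt i, ∑ n ∈ (range (x + 1)).filter (fun n : ℕ => n % q = s), Ng j n -
      (n₀ : ℝ) * K ≤
      ∑ n ∈ (range (x + 1)).filter
        (fun n : ℕ => q ∣ ((f i).eval (n : ℤ)).toNat ∧ ((f i).eval (n : ℤ)).toNat ≠ 0), Ng j n := by
    intro i j
    -- the root-class sum is the sum over `{n : (q : ℤ) ∣ fᵢ(n)}`
    have hfib : ∑ s ∈ Rt i, ∑ n ∈ (range (x + 1)).filter (fun n : ℕ => n % q = s), Ng j n =
        ∑ n ∈ (range (x + 1)).filter (fun n : ℕ => (q : ℤ) ∣ (f i).eval (n : ℤ)), Ng j n := by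
      rw [← sum_fiberwise_of_maps_to (s := (range (x + 1)).filter
        (fun n : ℕ => (q : ℤ) ∣ (f i).eval (n : ℤ))) (t := Rt i) (g := fun n : ℕ => n % q)]
      · refine sum_congr rfl fun s hs => ?_
        refine sum_congr ?_ fun _ _ => rfl
        ext n
        simp only [mem_filter, mem_range]
        constructor
        · rintro ⟨hn, hmod⟩
          refine ⟨⟨hn, ?_⟩, hmod⟩
          rw [dvd_eval_iff_dvd_eval_mod, hmod]
          exact (mem_filter.1 hs).2
        · rintro ⟨⟨hn, -⟩, hmod⟩
          exact ⟨hn, hmod⟩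
      · intro n hn
        rw [mem_filter] at hn
        rw [hRt, mem_filter, mem_range]
        exact ⟨Nat.mod_lt n hq0, (dvd_eval_iff_dvd_eval_mod (f i) q n).1 hn.2⟩
    rw [hfib, sum_filter, sum_filter]
    -- termwise: `[q ∣ fᵢ(n)] Ng ≤ [q ∣ fᵢ(n)⁺ ≠ 0] Ng + [n < n₀] K`
    have hterm : ∀ n ∈ range (x + 1),
        (if (q : ℤ) ∣ (f i).eval (n : ℤ) then Ng j n else 0) ≤
          (if q ∣ ((f i).eval (n : ℤ)).toNat ∧ ((f i).eval (n : ℤ)).toNat ≠ 0 then Ng j n else 0) +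
            (if n < n₀ then K else 0) := by
      intro n hn
      have h0 := hNg0 j n
      have hK' := hNgK j n hn
      by_cases hd : (q : ℤ) ∣ (f i).eval (n : ℤ)
      · rw [if_pos hd]
        by_cases hP : q ∣ ((f i).eval (n : ℤ)).toNat ∧ ((f i).eval (n : ℤ)).toNat ≠ 0
        · rw [if_pos hP]
          split_ifs <;> linarith
        · rw [if_neg hP]
          have hlt : n < n₀ := by
            by_contra hge
            exact hP (dvd_toNat_and_ne_zero_iff.2 ⟨hn₀ i n (not_lt.1 hge), hd⟩)
          rw [if_pos hlt]
          linarith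
      · rw [if_neg hd]
        have : ¬ (q ∣ ((f i).eval (n : ℤ)).toNat ∧ ((f i).eval (n : ℤ)).toNat ≠ 0) := fun hP =>
          hd (dvd_toNat_and_ne_zero_iff.1 hP).2
        rw [if_neg this]
        split_ifs <;> linarith
    have hsumK : ∑ n ∈ range (x + 1), (if n < n₀ then K else 0) ≤ (n₀ : ℝ) * K := by
      rw [← sum_filter]
      calc ∑ n ∈ (range (x + 1)).filter (fun n => n < n₀), K
          = (#((range (x + 1)).filter (fun n => n < n₀)) : ℝ) * K := by
            rw [sum_const, nsmul_eq_mul]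
        _ ≤ (n₀ : ℝ) * K := by
            refine mul_le_mul_of_nonneg_right ?_ hK0
            have : #((range (x + 1)).filter (fun n => n < n₀)) ≤ #(range n₀) :=
              card_le_card fun n hn => by
                rw [mem_filter] at hn
                exact mem_range.2 hn.2
            rw [card_range] at this
            exact_mod_cast this
    have h1 := sum_le_sum hterm
    rw [sum_add_distrib] at h1
    linarith
  -- Claim B: `#{n ≤ x : q ∣ fᵢ(n)⁺ ≠ 0}/Y ≤ #Rt_i (1/q + 1/Y)`
  have hB : ∀ i, (#((range (x + 1)).filter
      (fun n : ℕ => q ∣ ((f i).eval (n : ℤ)).toNat ∧ ((f i).eval (n : ℤ)).toNat ≠ 0)) : ℝ) /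
        ((x : ℝ) + 1) ≤ (#(Rt i) : ℝ) * (1 / (q : ℝ) + 1 / ((x : ℝ) + 1)) := fun i => by
    have h := card_filter_dvd_toNat_div_le (f i) hq0 x
    rwa [polyRootCountMod_single] at h
  /- ### the per-pair bound -/
  have hpair : ∀ i j,
      -((D * |Cg j| + 4 * K * ((n₀ : ℝ) + D)) *
          (ArithmeticFunction.vonMangoldt q / ((q : ℝ) * Real.log x))) ≤
        (∑ n ∈ (range (x + 1)).filter
            (fun n : ℕ => q ∣ ((f i).eval (n : ℤ)).toNat ∧ ((f i).eval (n : ℤ)).toNat ≠ 0), Ng j n) /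
            ((x : ℝ) + 1) -
          (#((range (x + 1)).filter
              (fun n : ℕ => q ∣ ((f i).eval (n : ℤ)).toNat ∧ ((f i).eval (n : ℤ)).toNat ≠ 0)) : ℝ) /
              ((x : ℝ) + 1) *
            ((∑ n ∈ range (x + 1), Ng j n) / ((x : ℝ) + 1)) := by
    intro i j
    set t : ℝ := ArithmeticFunction.vonMangoldt q / ((q : ℝ) * Real.log x) with ht
    set Ej : ℝ := (∑ n ∈ range (x + 1), Ng j n) / ((x : ℝ) + 1) with hEj
    set ρ : ℝ := (#(Rt i) : ℝ) with hρdef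
    set Fi : ℝ := (#((range (x + 1)).filter
      (fun n : ℕ => q ∣ ((f i).eval (n : ℤ)).toNat ∧ ((f i).eval (n : ℤ)).toNat ≠ 0)) : ℝ) with hFi
    have hρ0 : 0 ≤ ρ := Nat.cast_nonneg _
    have hρD' : ρ ≤ D := hRt_card i
    have hE0 : 0 ≤ Ej := hEj0 j
    have hEK : Ej ≤ K := hEjK j
    -- RAL summed over the root classes
    have hRALsum : ∑ s ∈ Rt i, (1 / (q : ℝ) * Ej - Cg j * ArithmeticFunction.vonMangoldt q /
        ((q : ℝ) * Real.log x)) ≤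
        ∑ s ∈ Rt i, (∑ n ∈ (range (x + 1)).filter (fun n : ℕ => n % q = s), Ng j n) / ((x : ℝ) + 1) :=
      sum_le_sum fun s hs => hRAL' j s (hRt_lt i s hs)
    rw [sum_const, nsmul_eq_mul, ← sum_div] at hRALsum
    -- combine with Claim A (divided by `Y`) and Claim B
    have hA' : (∑ s ∈ Rt i, ∑ n ∈ (range (x + 1)).filter (fun n : ℕ => n % q = s), Ng j n) /
        ((x : ℝ) + 1) - (n₀ : ℝ) * K / ((x : ℝ) + 1) ≤
        (∑ n ∈ (range (x + 1)).filter
          (fun n : ℕ => q ∣ ((f i).eval (n : ℤ)).toNat ∧ ((f i).eval (n : ℤ)).toNat ≠ 0), Ng j n) /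
          ((x : ℝ) + 1) := by
      rw [← sub_div]
      exact div_le_div_of_nonneg_right (hA i j) hY0.le
    have hB' : Fi / ((x : ℝ) + 1) * Ej ≤ ρ * (1 / (q : ℝ) + 1 / ((x : ℝ) + 1)) * Ej :=
      mul_le_mul_of_nonneg_right (hB i) hE0
    -- the `1/Y` losses
    have hY1 : (n₀ : ℝ) * K / ((x : ℝ) + 1) ≤ 4 * K * (n₀ : ℝ) * t := by
      have h1 : (n₀ : ℝ) * K / ((x : ℝ) + 1) = (n₀ : ℝ) * K * (1 / ((x : ℝ) + 1)) := by ring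
      rw [h1]
      have h2 : (n₀ : ℝ) * K * (1 / ((x : ℝ) + 1)) ≤ (n₀ : ℝ) * K *
          (4 * ArithmeticFunction.vonMangoldt q / ((q : ℝ) * Real.log x)) :=
        mul_le_mul_of_nonneg_left hsmall (by positivity)
      have h3 : (n₀ : ℝ) * K * (4 * ArithmeticFunction.vonMangoldt q / ((q : ℝ) * Real.log x)) =
          4 * K * (n₀ : ℝ) * t := by rw [ht]; ring
      linarith
    have hY2 : ρ * (1 / ((x : ℝ) + 1)) * Ej ≤ 4 * K * D * t := by
      have h1 : ρ * (1 / ((x : ℝ) + 1)) * Ej ≤ D * (4 * ArithmeticFunction.vonMangoldt q /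
          ((q : ℝ) * Real.log x)) * K := by
        refine mul_le_mul (mul_le_mul hρD' hsmall (by positivity) hD0) hEK hE0 (by positivity)
      have h2 : D * (4 * ArithmeticFunction.vonMangoldt q / ((q : ℝ) * Real.log x)) * K =
          4 * K * D * t := by rw [ht]; ring
      linarith
    have hCabs : ρ * (Cg j * ArithmeticFunction.vonMangoldt q / ((q : ℝ) * Real.log x)) ≤
        D * |Cg j| * t := by
      have h1 : Cg j * ArithmeticFunction.vonMangoldt q / ((q : ℝ) * Real.log x) = Cg j * t := by
        rw [ht]; ring
      rw [h1]
      calc ρ * (Cg j * t) ≤ ρ * (|Cg j| * t) :=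
            mul_le_mul_of_nonneg_left (mul_le_mul_of_nonneg_right (le_abs_self _) ht0) hρ0
        _ ≤ D * (|Cg j| * t) := mul_le_mul_of_nonneg_right hρD' (by positivity)
        _ = D * |Cg j| * t := by ring
    -- bookkeeping
    have e1 : ρ * (1 / (q : ℝ) * Ej - Cg j * ArithmeticFunction.vonMangoldt q / ((q : ℝ) * Real.log x)) =
        ρ * (1 / (q : ℝ)) * Ej - ρ * (Cg j * ArithmeticFunction.vonMangoldt q / ((q : ℝ) * Real.log x)) := by
      ring
    have e2 : ρ * (1 / (q : ℝ) + 1 / ((x : ℝ) + 1)) * Ej =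
        ρ * (1 / (q : ℝ)) * Ej + ρ * (1 / ((x : ℝ) + 1)) * Ej := by ring
    rw [e1] at hRALsum
    rw [e2] at hB'
    have e3 : (D * |Cg j| + 4 * K * ((n₀ : ℝ) + D)) * t =
        D * |Cg j| * t + 4 * K * (n₀ : ℝ) * t + 4 * K * D * t := by ring
    rw [e3]
    linarith
  /- ### summing over the pairs `(i, j)` -/
  obtain ⟨T, hT⟩ : ∃ T : Fin k → ℝ, T = fun i : Fin k =>
      (∑ n ∈ (range (x + 1)).filter
          (fun n : ℕ => q ∣ ((f i).eval (n : ℤ)).toNat ∧ ((f i).eval (n : ℤ)).toNat ≠ 0), Nf n) /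
          ((x : ℝ) + 1) -
        (#((range (x + 1)).filter
            (fun n : ℕ => q ∣ ((f i).eval (n : ℤ)).toNat ∧ ((f i).eval (n : ℤ)).toNat ≠ 0)) : ℝ) /
            ((x : ℝ) + 1) *
          ((∑ n ∈ range (x + 1), Nf n) / ((x : ℝ) + 1)) := ⟨_, rfl⟩
  -- the `i`-th term of the goal, in `Ng`-form
  have hTi : ∀ i, ∑ j, ((∑ n ∈ (range (x + 1)).filter
            (fun n : ℕ => q ∣ ((f i).eval (n : ℤ)).toNat ∧ ((f i).eval (n : ℤ)).toNat ≠ 0), Ng j n) /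
            ((x : ℝ) + 1) -
          (#((range (x + 1)).filter
              (fun n : ℕ => q ∣ ((f i).eval (n : ℤ)).toNat ∧ ((f i).eval (n : ℤ)).toNat ≠ 0)) : ℝ) /
              ((x : ℝ) + 1) *
            ((∑ n ∈ range (x + 1), Ng j n) / ((x : ℝ) + 1))) = T i := by
    intro i
    rw [hT]
    simp only
    simp_rw [hNfsum]
    rw [sum_comm (s := (range (x + 1)).filter _), sum_comm (s := range (x + 1)),
      sum_sub_distrib, ← sum_div, ← mul_sum, ← sum_div]
  have hgoal : -((∑ _i : Fin k, ∑ j : Fin k, (D * |Cg j| + 4 * K * ((n₀ : ℝ) + D))) *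
      ArithmeticFunction.vonMangoldt q / ((q : ℝ) * Real.log x)) ≤ ∑ i, T i := by
    have h1 : ∀ i, -((∑ j : Fin k, (D * |Cg j| + 4 * K * ((n₀ : ℝ) + D))) *
        (ArithmeticFunction.vonMangoldt q / ((q : ℝ) * Real.log x))) ≤ T i := by
      intro i
      rw [← hTi i, sum_mul, ← sum_neg_distrib]
      exact sum_le_sum fun j _ => hpair i j
    have h2 := sum_le_sum fun i (_ : i ∈ (univ : Finset (Fin k))) => h1 i
    rw [sum_neg_distrib, ← sum_mul] at h2
    rw [mul_div_assoc]
    exact h2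
  rw [hT, hNf] at hgoal
  exact hgoal

end Summit.Parity.BatemanHorn.Cruxes.SystemMomentDeficit.Ideator3Sketch
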